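import Literature.MathematicalPhysics.QuantumFieldTheory.Balaban1983to89.B9RowSum261DefiniteFaces

/-!
# `Balaban1983to89.B9Thm39WholeBlk` — [B9] Theorem 3.9 (p. 413) and its kernel-summation leaf (rows 15–16 of the N06 knit) OVER AN
# ABSTRACT CARRIER `X` WITH A BLOCK MAP `blk : X → 𝔅`, in [4]'s block-majorant currency (2.51) — the letters of (3.87), (3.95), (3.98)
# acting on `X → ℝ` (so that 𝔤-valued block functions, 𝔤 ⊂ M_N(ℂ), are admitted: `X` = blocks × real coordinates of 𝔤), the
# carrier-kernel reading as a MAJORIZATION with a free constant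

T. Bałaban, *Propagators for lattice gauge theories in a background field*, Commun. Math. Phys. **99** (1985) 389–434
[`Balaban1985BackgroundPropagators`, "B9"]; [4] = T. Bałaban, *Propagators and renormalization transformations for lattice gauge
theories. II*, Commun. Math. Phys. **96** (1984) 223–250 [`Balaban1984PropagatorsII`].

statement-level skeleton of published theorems with citation tags; proofs where landed; nothing here is a claim about the
Yang–Mills mass gap

THE PRINTED LOCI (verbatim).  [B9] p. 411: *"Q′G′²Q′\*C₀ = I + Σ_□(1 − □̃)Q′G′²Q′\*h_□C_□h_□ + Σ_□ □̃Q′(G′² − G′²_□)Q′\*h_□C_□h_□ +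
Σ_□[□̃Q′G′²_□Q′\*, h_□]C_□h_□ = I − R (3.95).  By the same estimates as in [4], especially (2.83)–(2.85), we can see that the operator R
is small and (Q′G′²Q′\*)⁻¹ = C₀(I − R)⁻¹ = Σ_{n=0}^∞ C₀Rⁿ (3.96)"*;  p. 413, Theorem 3.9: *"For M sufficiently large, and a configuration
U satisfying (3.35), the operator Q′G′²Q′\* has an inverse which can be represented as (Q′G′²Q′\*)⁻¹ = Σ_ω R′₀(X₀)R′_{α₁}(X₁)·⋯·R′_{αₙ}(Xₙ)
(3.98) … |(R′₀(X₀)R′_{α₁}(X₁)·⋯·R′_{αₙ}(Xₙ))(y, y′)| ≦ O(1)(L^jη)^{−4}(L^{j′}η)^{−d}O(M^{−1/2})^{|ω|}M^{−½|ω|}e^{−½δ₀d(ω,y,y′)}, y ∈ Λ_j,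
y′ ∈ Λ_{j′} (3.99) … This theorem implies Theorem 3.2."*;  p. 395: *"All these operators are defined on the space of functions on
subsets of T_η with values in the algebra 𝔤"*;  [4] p. 232, (2.51): *"|(Tλ)(x)| ≦ K(y, y′)|λ|, x ∈ B^j(y), supp λ ⊂ B^{j′}(y′)"*;
[4] p. 238, (2.85): *"|R(y, y′)| ≦ O(M⁻¹)e^{−δ₁d(y,y′)}(L^{j′}η)^{−d}"*.

WHY THIS FILE (successor of the seat's `B9Thm39Whole` ∕ `B9Thm39WholeGeneric` ∕ `B9RowSum261DefiniteFaces`).  The landed rows-15–16 letters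
`B9Thm39Whole.Ops39` act on SCALAR functions on 𝔅 (`Module.End ℝ (g.Site → ℝ)`) and the carrier reading `B9Thm39Whole.KerReads`
demands EQUALITY of the carrier kernel `Cinv.ker U y y′` with the scalar inverse kernel.  Print's operators act on 𝔤-VALUED block functions
(p. 395); at a background U ≠ 1 the operator (Q′(U)G′²(U)Q′\*(U))⁻¹ is not a scalar operator on 𝔅, its kernel (y, y′) ↦ End(𝔤) is
read through a norm (the N06 operator layer reads `sup_{|E| ≤ 1} ‖(C(U)(δ_{y′} ⊗ E))(y)‖`).  So at a non-abelian instance the scalar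
letters are instantiable only by U-independent (flat) data — a MODEL WALL of the typed face (invisible at U = 1, where everything is
scalar ⊗ identity).  The sibling seat's Theorem-3.7 letters `B9Thm37Whole.Ops` avoid this by working over an ABSTRACT carrier `X` with a
block map `blk : X → g.Site` — exactly the setting of [4]'s majorant calculus `B6RandomWalk.HasMajorant blk` ((2.51)), in which the
tree's Prop. 2.2∕2.3 chain `B6Prop23Chain` is already typed.  THIS FILE re-types rows 15–16 in that setting:

* §1 `Ops39Blk g B X ι κ` — the letters of (3.87), (3.95), (3.98) at one member as functions of U, acting on `X → ℝ`, with `blk : X →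
  𝔅`; `C0Blk`, `RopBlk` (C₀ of (3.87), R of (3.95), spelled verbatim as in `B9Thm39Whole`), the walk factors `walkOpsBlk` ∕ `walkSetsBlk`;
  `blockKer blk T y y′` — the norm of the (y, y′) BLOCK of an operator T on `X → ℝ` (sup over x ∈ blk⁻¹y of Σ_{x′ ∈ blk⁻¹y′}
  |T(δ_{x′})(x)|: the least (2.51)-majorant, `blockKer_le_of_hasMajorant`); `Conv348Blk 𝔬 B₁ δ₁ U` — L(U) has a two-sided inverse with the
  (2.51)-majorant B₁(L^jη)^{−4}e^{−δ₁d(y,y′)} (= (3.48) in [4]'s (2.86) form: the pairing weight (L^{j′}η)^{−d} is the kernel-w.r.t.-integral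
  convention); ★ `EK39OfOpsBlk 𝔬 rd d B₁ δ₁ : B9.RWKernelExpansion g B` — every field pinned (`kterm` = block norm of the ω-term ∕ (L^{j′}η)^d,
  print's kernel convention; `Converges := Conv348Blk`).
* §2 the hypothesis schemas (printed shape; nothing asserted), (2.51)-currency twins of the scalar ones: `StaticOK39Blk`, `Local348Blk`
  ((3.48) for every C_□(U) as the majorant B₀(L^jη)^{−4}e^{−δ₀d}), `Identities395Blk`, `Small285Blk` ([4] (2.85) verbatim as the majorant
  θ₀M⁻¹e^{−r·d}), `Factors389Blk`, `Locality39Blk`; and the READING `KerReadsLe 𝔬 Cv d cR` — |Cv(U)(y, y′)| ≦ cR·(L^{j′}η)^{−d}·blockKer(T)(y, y′)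
  for the inverse T of L(U): a MAJORIZATION with a free constant (norm equivalence on 𝔤), not an equality.
* §3 the engine over `X` ([folklore] ∕ [4] Prop. 2.2 by name): `entry_abs_le_of_hasMajorant`, `blockKer_nonneg`, `blockKer_le_of_hasMajorant`,
  ★ `isUnit_one_sub_of_majorantBlk` (I − R invertible from the majorant θe^{−r·d}, (2.63) with constant c and θc < 1 — by
  `B6Prop23Chain.majorant_pow_265W` and the block decomposition `sum_blockPiece`; NO fibre-cardinality input), `inverse_of_395Blk`
  (`B6Prop23Chain.majorant_of_fixedPoint_266W`), `L_mul_C0_eqBlk` ((3.95), any ring: `B9Thm39Sum.eq395_oneSub`), `c0_majorantBlk`,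
  `conv348Blk_of_local348` (B₁ = 2NB₀c′, δ₁ = (1 − α′)r under M ≧ 2θ₀c′ — the constants of the scalar face), `locDep_EK39OfOpsBlk`,
  `kterm_EK39OfOpsBlk_le` ((3.99), by the seat's X-generic `B9Thm39WholeGeneric.term399_majorantWith`).
* the family-level leaves (`B9.Thm39Printed`, `B9.RWKernelSumYields` at the datum), the faces at the definite (2.61) constant `rowConst261` and at
  def-Y's operator layer, and the bookkeeping «scalar face = the case X = 𝔅, blk = id» are the sibling `B9Thm39WholeBlkFaces`.

HONEST SCOPE.  Nothing of print is asserted: (3.48) for the C_□, the local inverse identities, the smallness of R ((2.83)–(2.85) by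
reference; cell GAPS G-B9-05 ∕ G-B9-07), the factor bounds ((3.89)-type; print: *"It is difficult to make the last statement more
precise"*), the locality inputs, [4] Lemma 2.1 (2.61) and the metric facts are HYPOTHESES of printed shape; the re-expansion of
pp. 411–412 is not reproduced; heteromorphic factors and the *"additional power of L^jη"* are not modelled; the block norm `blockKer`
reads |K(y, y′)| of an End(𝔤)-valued kernel in real coordinates (equivalent to the operator norm up to a dimension constant — absorbed
by `KerReadsLe`'s cR).  Value: kernel-checked bookkeeping removing a model wall of the typed face; NOT a node discharge, NOT summit
progress; one finite 𝕋⁴ programme — nothing continuum, nothing about the mass gap.  Cell `pub-ymgap` (HUMAN RULING D-0062), Track A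
node N06 [B9], seat `pub-ymgap-dag-n06-j` (harness re-seat gen 4), 2026-08-27.
-/

namespace Literature.MathematicalPhysics.QuantumFieldTheory.Balaban1983to89.B9Thm39WholeBlk

open Literature.MathematicalPhysics.QuantumFieldTheory.Balaban1983to89
open Finset B6RandomWalk B9Thm37Sum B9Thm34Ext B9Thm34Inv B9Thm39Sum B9Cor38Whole B9Thm39Whole B9Thm39WholeGeneric
open B6Lemma21Repaired

noncomputable section

/-! ## §0 The [B9] geometry read as a [4] geometry (no transport data) -/

/-- The [B9] geometry `g` read as a [4] (`B6.Geometry`) datum with NO extra transport data (R := 0, (2.1)–(2.2)-slot := `True`) — the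
index at which [4]'s majorant predicate `B6RandomWalk.HasMajorant` and Lemma 2.1's `Ineq261With` are read below (`B9Thm34Ext.toB6`;
only `Site` and `dist` are ever used). [cite: Balaban1984PropagatorsII, (2.51) p.232 + (2.61) p.234 (bookkeeping)] -/
abbrev b6 (g : B9.Geometry) [Fintype g.Site] : B6.Geometry := toB6 g 0 True

/-! ## §1 The letters of (3.87), (3.95), (3.98) over an abstract carrier; C₀ and R; the block norm; the convergence content; the datum -/

section OneMember

variable {g : B9.Geometry} [Fintype g.Site] [DecidableEq g.Site] {B : B9.Backgrounds} {X ι κ : Type}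

/-- **THE LETTERS OF (3.87), (3.95) AND (3.98) AT ONE FAMILY MEMBER OVER AN ABSTRACT CARRIER**, as total functions of the background
configuration U, acting on the real functions on a carrier `X` fibred over the coarse lattice 𝔅 = `g.Site` by `blk` (p. 395: *"functions
… with values in the algebra 𝔤"* — e.g. `X` = 𝔅 × (real coordinates of 𝔤); [4] p. 231: the block map y^j(·)).  Over the cube index `ι` = 𝒟
(p. 408): `S □` = the sites of 𝔅 met by supp h_□, `h □` ∕ `chi □` = h_□ ∕ □̃ read on `X`; `L U` = Q′(U)G′²(U)Q′\*(U), `Lloc U □` = Q′G′²_□Q′\*,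
`Cl U □` = C_□(U) (p. 409).  Over the factor index `κ` = the pairs (α, X), α ≠ 0 (p. 413): `Sw c` = X ∩ 𝔅, `Rw U c` = R′_α(X).  A PARAMETER
RECORD — nothing is constructed or asserted (pattern of `B9Thm37Whole.Ops`, which has the same `blk`).
[cite: Balaban1985BackgroundPropagators, (3.87) p.409 + (3.95) p.411 + (3.98) p.413 + p.395; Balaban1984PropagatorsII, p.231] -/
structure Ops39Blk (g : B9.Geometry) (B : B9.Backgrounds) (X ι κ : Type) where
  blk : X → g.Site
  S : ι → Finset g.Site
  h : ι → X → ℝ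
  chi : ι → X → ℝ
  L : B.Cfg → Module.End ℝ (X → ℝ)
  Lloc : B.Cfg → ι → Module.End ℝ (X → ℝ)
  Cl : B.Cfg → ι → Module.End ℝ (X → ℝ)
  Sw : κ → Finset g.Site
  Rw : B.Cfg → κ → Module.End ℝ (X → ℝ)

variable [Fintype ι]

omit [Fintype g.Site] [DecidableEq g.Site] in
/-- **C₀ = Σ_{□∈𝒟} h_□C_□h_□** (3.87), spelled from the letters. [cite: Balaban1985BackgroundPropagators, (3.87) p.409] -/
def C0Blk (𝔬 : Ops39Blk g B X ι κ) (U : B.Cfg) : Module.End ℝ (X → ℝ) :=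
  ∑ i, mulOp (𝔬.h i) * 𝔬.Cl U i * mulOp (𝔬.h i)

omit [Fintype g.Site] [DecidableEq g.Site] in
/-- **The operator R of (3.95)**, spelled from the letters in the shape of `B9Thm39Sum.eq395_oneSub` (as `B9Thm39Whole.Rop`).
[cite: Balaban1985BackgroundPropagators, (3.95) p.411] -/
def RopBlk (𝔬 : Ops39Blk g B X ι κ) (U : B.Cfg) : Module.End ℝ (X → ℝ) :=
  -(∑ i, (1 - mulOp (𝔬.chi i)) * 𝔬.L U * (mulOp (𝔬.h i) * 𝔬.Cl U i * mulOp (𝔬.h i)) +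
      ∑ i, mulOp (𝔬.chi i) * (𝔬.L U - 𝔬.Lloc U i) * (mulOp (𝔬.h i) * 𝔬.Cl U i * mulOp (𝔬.h i)) +
      ∑ i, (mulOp (𝔬.chi i) * 𝔬.Lloc U i * mulOp (𝔬.h i) - mulOp (𝔬.h i) * (mulOp (𝔬.chi i) * 𝔬.Lloc U i)) *
        𝔬.Cl U i * mulOp (𝔬.h i))

omit [Fintype g.Site] [DecidableEq g.Site] [Fintype ι] in
/-- **The factors of the term of (3.98) for the walk ((0, □₀), (α₁, X₁), …, (αₙ, Xₙ))** at U: F₀ = h_{□₀}C_{□₀}(U)h_{□₀}, F_k = R′_{α_k}(X_k)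
(as `B9Thm39Whole.walkOps39`). [cite: Balaban1985BackgroundPropagators, (3.98) p.413] -/
def walkOpsBlk (𝔬 : Ops39Blk g B X ι κ) (U : B.Cfg) (q : ι) (ω : ℕ → κ) (k : ℕ) : Module.End ℝ (X → ℝ) :=
  if k = 0 then mulOp (𝔬.h q) * 𝔬.Cl U q * mulOp (𝔬.h q) else 𝔬.Rw U (ω k)

omit [Fintype g.Site] [DecidableEq g.Site] [Fintype ι] in
/-- The localisation sets along the walk: S_{□₀}, then X_k ∩ 𝔅 (as `B9Thm39Whole.walkSets39`).
[cite: Balaban1985BackgroundPropagators, (3.93) p.410 + Thm 3.9 p.413] -/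
def walkSetsBlk (𝔬 : Ops39Blk g B X ι κ) (q : ι) (ω : ℕ → κ) (k : ℕ) : Finset g.Site :=
  if k = 0 then 𝔬.S q else 𝔬.Sw (ω k)

omit [Fintype g.Site] [DecidableEq g.Site] [Fintype ι] in
/-- The head factor is h_{□₀}C_{□₀}h_{□₀}. [cite: Balaban1985BackgroundPropagators, (3.98) p.413] -/
theorem walkOpsBlk_zero (𝔬 : Ops39Blk g B X ι κ) (U : B.Cfg) (q : ι) (ω : ℕ → κ) :
    walkOpsBlk 𝔬 U q ω 0 = mulOp (𝔬.h q) * 𝔬.Cl U q * mulOp (𝔬.h q) := by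
  simp [walkOpsBlk]

omit [Fintype g.Site] [DecidableEq g.Site] [Fintype ι] in
/-- The k-th factor, k ≠ 0, is R′_{α_k}(X_k). [cite: Balaban1985BackgroundPropagators, (3.98) p.413] -/
theorem walkOpsBlk_of_ne (𝔬 : Ops39Blk g B X ι κ) (U : B.Cfg) (q : ι) (ω : ℕ → κ) {k : ℕ} (hk : k ≠ 0) :
    walkOpsBlk 𝔬 U q ω k = 𝔬.Rw U (ω k) := by
  simp [walkOpsBlk, hk]

omit [Fintype g.Site] [DecidableEq g.Site] [Fintype ι] in
/-- The head localisation set is S_{□₀}. [cite: Balaban1985BackgroundPropagators, (3.93) p.410] -/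
theorem walkSetsBlk_zero (𝔬 : Ops39Blk g B X ι κ) (q : ι) (ω : ℕ → κ) : walkSetsBlk 𝔬 q ω 0 = 𝔬.S q := by
  simp [walkSetsBlk]

omit [Fintype g.Site] [DecidableEq g.Site] [Fintype ι] in
/-- The k-th localisation set, k ≠ 0, is X_k ∩ 𝔅. [cite: Balaban1985BackgroundPropagators, Thm 3.9 p.413] -/
theorem walkSetsBlk_of_ne (𝔬 : Ops39Blk g B X ι κ) (q : ι) (ω : ℕ → κ) {k : ℕ} (hk : k ≠ 0) :
    walkSetsBlk 𝔬 q ω k = 𝔬.Sw (ω k) := by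
  simp [walkSetsBlk, hk]

variable [Fintype X] [DecidableEq X]

omit [Fintype g.Site] [Fintype ι] in
/-- **THE NORM OF THE (y, y′) BLOCK OF AN OPERATOR on `X → ℝ`**: sup over x ∈ blk⁻¹(y) of Σ_{x′ ∈ blk⁻¹(y′)} |T(δ_{x′})(x)| — the ∞→∞
norm of the block, i.e. the LEAST K(y, y′) in [4]'s (2.51) *"|(Tλ)(x)| ≦ K(y, y′)|λ|, x ∈ B(y), supp λ ⊂ B(y′)"* (`blockKer_le_of_hasMajorant`).
For X = 𝔅 × (real coordinates of 𝔤) it reads the norm |K(y, y′)| of an End(𝔤)-valued kernel entry in coordinates.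
[cite: Balaban1984PropagatorsII, (2.51) p.232; Balaban1985BackgroundPropagators, (3.48) p.398] -/
def blockKer (blk : X → g.Site) (T : Module.End ℝ (X → ℝ)) (y y' : g.Site) : ℝ :=
  ⨆ x : {x : X // blk x = y}, ∑ x' ∈ univ.filter (fun x' => blk x' = y'), |entry T x.1 x'|

omit [DecidableEq g.Site] [Fintype ι] [Fintype X] [DecidableEq X] in
/-- **«(Q′G′²Q′\*)⁻¹ = C₀(I − R)⁻¹ = Σ C₀Rⁿ … convergent in the weighted supremum norm on 𝔅 appearing in the inequality (3.48)»** (3.96) READ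
ON THE INVERSE, in [4]'s (2.51)∕(2.86) currency: L(U) has a two-sided inverse T on `X → ℝ` with the block majorant B₁(L^jη)^{−4}e^{−δ₁d(y,y′)}.
[cite: Balaban1985BackgroundPropagators, (3.96) p.411 + Thm 3.2 (3.48) p.398; Balaban1984PropagatorsII, (2.86) p.238] -/
def Conv348Blk (𝔬 : Ops39Blk g B X ι κ) (B₁ δ₁ : ℝ) (U : B.Cfg) : Prop :=
  ∃ T : Module.End ℝ (X → ℝ), T * 𝔬.L U = 1 ∧ 𝔬.L U * T = 1 ∧
    HasMajorant (g := b6 g) 𝔬.blk T (fun (a b : g.Site) => B₁ * g.len a ^ (-(4 : ℝ)) * Real.exp (-(δ₁ * g.dist a b)))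

omit [Fintype ι] in
/-- ★ **THE KERNEL EXPANSION DATUM OF THEOREM 3.9 OVER THE CARRIER `X`, EVERY FIELD PINNED** (twin of `B9Thm39Whole.EK39OfOps`): walks
(n, □₀, (α_k, X_k)_k), |ω| = n, d(ω, y, y′) = `B9Cor38Whole.minLen` over X_k ∩ 𝔅, `kterm U ω y y′` = the block norm of the ω-term
h_{□₀}C_{□₀}h_{□₀}·R′_{α₁}(X₁)⋯R′_{αₙ}(Xₙ) at (y, y′) divided by the pairing weight (L^{j′}η)^d (`B9Thm34Inv.vol g d`; print's kernels are
w.r.t. the lattice integral), the localisation clause as the equality of the term operators at agreeing configurations, `Converges :=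
Conv348Blk`. [cite: Balaban1985BackgroundPropagators, Thm 3.9 (3.98)–(3.99) p.413 + (3.96) p.411 + (3.93) p.410] -/
def EK39OfOpsBlk (𝔬 : Ops39Blk g B X ι κ) (rd : WalkReading39 B ι κ) (d : ℕ) (B₁ δ₁ : ℝ) : B9.RWKernelExpansion g B where
  Walk := ℕ × ι × (ℕ → κ)
  wlen w := w.1
  wdist w y y' := minLen g.dist (walkSetsBlk 𝔬 w.2.1 w.2.2) w.1 y y'
  kterm U w y y' := blockKer 𝔬.blk (lprod (walkOpsBlk 𝔬 U w.2.1 w.2.2) w.1) y y' / vol g d y'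
  LocDep U w := ∀ U' : B.Cfg, rd.AgreeC w.2.1 U U' → (∀ k, 1 ≤ k → k ≤ w.1 → rd.Agree (w.2.2 k) U U') →
    lprod (walkOpsBlk 𝔬 U w.2.1 w.2.2) w.1 = lprod (walkOpsBlk 𝔬 U' w.2.1 w.2.2) w.1
  Converges U := Conv348Blk 𝔬 B₁ δ₁ U

omit [Fintype ι] in
/-- The convergence predicate of `EK39OfOpsBlk` IS `Conv348Blk` (by `Iff.rfl`). [cite: Balaban1985BackgroundPropagators, (3.96) p.411] -/
theorem converges_EK39OfOpsBlk (𝔬 : Ops39Blk g B X ι κ) (rd : WalkReading39 B ι κ) (d : ℕ) (B₁ δ₁ : ℝ) (U : B.Cfg) :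
    (EK39OfOpsBlk 𝔬 rd d B₁ δ₁).Converges U ↔ Conv348Blk 𝔬 B₁ δ₁ U :=
  Iff.rfl

/-! ## §2 The hypothesis schemas over the carrier (printed shape; nothing asserted) -/

omit [DecidableEq g.Site] [Fintype X] [DecidableEq X] in
/-- **THE STATIC DATA AT ONE MEMBER** (independent of U), carrier version of `B9Thm39Whole.StaticOK39`: the metric facts ((2.54), d(y, y) = 0,
d ≧ 0), L^jη > 0, |h_□| ≦ 1 on `X` with h_□(x) ≠ 0 only over S_□, Σ_□h_□² = 1 (p. 408), □̃h_□ = h_□, every site of 𝔅 in at most N of the S_□.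
[cite: Balaban1985BackgroundPropagators, (3.87) p.409 + p.408; Balaban1984PropagatorsII, (2.46) p.231 + (2.54) p.233] -/
structure StaticOK39Blk (𝔬 : Ops39Blk g B X ι κ) (N : ℝ) : Prop where
  tri : ∀ a b c : g.Site, g.dist a c ≤ g.dist a b + g.dist b c
  refl : ∀ y : g.Site, g.dist y y = 0
  dnn : ∀ y y' : g.Site, 0 ≤ g.dist y y'
  lenpos : ∀ y : g.Site, 0 < g.len y
  hh : ∀ i x, |𝔬.h i x| ≤ 1
  hS : ∀ i x, 𝔬.h i x ≠ 0 → 𝔬.blk x ∈ 𝔬.S i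
  hpu : ∀ x, ∑ i, 𝔬.h i x ^ 2 = 1
  hchi : ∀ i x, 𝔬.chi i x * 𝔬.h i x = 𝔬.h i x
  cnt : ∀ a : g.Site, (∑ i, if a ∈ 𝔬.S i then (1 : ℝ) else 0) ≤ N

omit [DecidableEq g.Site] [Fintype ι] [Fintype X] [DecidableEq X] in
/-- **«THE OPERATORS … C_□(U) … SATISFY ALL THE INEQUALITIES OF THEOREMS 3.1–3.3»** (p. 409) at U — Theorem 3.2 (3.48) for every local inverse
C_□(U) as the (2.51)-majorant B₀(L^jη)^{−4}e^{−δ₀d(y,y′)} ([4] (2.86) form).  A HYPOTHESIS SCHEMA, not asserted.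
[cite: Balaban1985BackgroundPropagators, p.409 + Thm 3.2 (3.48) p.398; Balaban1984PropagatorsII, (2.86) p.238] -/
structure Local348Blk (𝔬 : Ops39Blk g B X ι κ) (B₀ δ₀ : ℝ) (U : B.Cfg) : Prop where
  cl : ∀ i : ι, HasMajorant (g := b6 g) 𝔬.blk (𝔬.Cl U i)
    (fun (a b : g.Site) => B₀ * g.len a ^ (-(4 : ℝ)) * Real.exp (-(δ₀ * g.dist a b)))

omit [Fintype g.Site] [DecidableEq g.Site] [Fintype ι] [Fintype X] [DecidableEq X] in
/-- **The local inverse identities at U**: L_□·C_□ = I (p. 409).  Nothing asserted. [cite: Balaban1985BackgroundPropagators, (3.87) p.409 + (3.95) p.411] -/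
structure Identities395Blk (𝔬 : Ops39Blk g B X ι κ) (U : B.Cfg) : Prop where
  inv : ∀ i : ι, 𝔬.Lloc U i * 𝔬.Cl U i = 1

omit [DecidableEq g.Site] [Fintype X] [DecidableEq X] in
/-- **«BY THE SAME ESTIMATES AS IN [4], ESPECIALLY (2.83)–(2.85), WE CAN SEE THAT THE OPERATOR R IS SMALL»** (p. 411) — [4] (2.85) *"|R(y, y′)| ≦
O(M⁻¹)e^{−δ₁d(y,y′)}(L^{j′}η)^{−d}"* as the (2.51)-majorant θ₀M⁻¹e^{−r·d(y,y′)} of R of (3.95) (the kernel-w.r.t.-integral factor (L^{j′}η)^{−d} is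
the pairing weight).  BY REFERENCE (cell GAPS G-B9-05 ∕ G-B9-07); nothing asserted.
[cite: Balaban1985BackgroundPropagators, (3.95)–(3.97) pp.411–412; Balaban1984PropagatorsII, (2.83)–(2.85) p.238] -/
structure Small285Blk (𝔬 : Ops39Blk g B X ι κ) (θ₀ r : ℝ) (U : B.Cfg) : Prop where
  rk : HasMajorant (g := b6 g) 𝔬.blk (RopBlk 𝔬 U) (fun (a b : g.Site) => θ₀ * g.M⁻¹ * Real.exp (-(r * g.dist a b)))

omit [DecidableEq g.Site] [Fintype ι] [Fintype X] [DecidableEq X] in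
/-- **THE FACTORS R′_α(X), α ≠ 0** (p. 413: *"localized in X … satisfies a bound of the type (3.89)"*): the (2.51)-majorant
1_X(y)·θ₀M⁻¹·e^{−δ₀d(y,y′)}.  Print declines to make the factor bound precise; a HYPOTHESIS SCHEMA of (3.89)-shape.
[cite: Balaban1985BackgroundPropagators, (3.89) p.409 + Thm 3.9 p.413] -/
structure Factors389Blk (𝔬 : Ops39Blk g B X ι κ) (θ₀ δ₀ : ℝ) (U : B.Cfg) : Prop where
  rw : ∀ c : κ, HasMajorant (g := b6 g) 𝔬.blk (𝔬.Rw U c)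
    (fun (a b : g.Site) => if a ∈ 𝔬.Sw c then θ₀ * g.M⁻¹ * Real.exp (-(δ₀ * g.dist a b)) else 0)

omit [Fintype g.Site] [DecidableEq g.Site] [Fintype ι] [Fintype X] [DecidableEq X] in
/-- **THE PRINTED LOCALITY INPUTS** (p. 410, p. 413: the factors depend on U restricted to □̃⁵ resp. X̃⁵), as in `B9Thm39Whole.Locality39`.
Nothing asserted. [cite: Balaban1985BackgroundPropagators, Cor. 3.8 p.410 + Thm 3.9 p.413] -/
structure Locality39Blk (𝔬 : Ops39Blk g B X ι κ) (rd : WalkReading39 B ι κ) : Prop where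
  cl : ∀ (q : ι) (U U' : B.Cfg), rd.AgreeC q U U' →
    mulOp (𝔬.h q) * 𝔬.Cl U q * mulOp (𝔬.h q) = mulOp (𝔬.h q) * 𝔬.Cl U' q * mulOp (𝔬.h q)
  rw : ∀ (c : κ) (U U' : B.Cfg), rd.Agree c U U' → 𝔬.Rw U c = 𝔬.Rw U' c

omit [Fintype g.Site] [Fintype ι] in
/-- ★ **THE CARRIER KERNEL READS THE INVERSE, AS A MAJORIZATION**: the site kernel `Cv` (the N06 bundle's `Cinv` — |(Q′(U)G′²(U)Q′\*(U))⁻¹(y, y′)| of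
Theorem 3.2, a NORM of an End(𝔤)-valued kernel entry) is dominated, at every U at which L(U) has a two-sided inverse T on `X → ℝ`, by
cR·(L^{j′}η)^{−d}·(block norm of T at (y, y′)) — cR a free constant (norm equivalence between the coordinate block norm and the reading's
norm).  A READING HYPOTHESIS, dischargeable at a genuine letter; replaces the scalar EQUALITY `B9Thm39Whole.KerReads`.
[cite: Balaban1985BackgroundPropagators, Thm 3.2 (3.48) p.398 + (3.96) p.411 + p.395] -/
def KerReadsLe (𝔬 : Ops39Blk g B X ι κ) (Cv : B9.SiteKernel g B) (d : ℕ) (cR : ℝ) : Prop :=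
  ∀ (U : B.Cfg) (T : Module.End ℝ (X → ℝ)), T * 𝔬.L U = 1 → 𝔬.L U * T = 1 →
    ∀ y y' : g.Site, |Cv.ker U y y'| ≤ cR * (vol g d y')⁻¹ * blockKer 𝔬.blk T y y'

/-! ## §3 The engine over the carrier and Theorem 3.9 at one member and one configuration -/

omit [DecidableEq g.Site] [Fintype ι] [Fintype X] in
/-- A (2.51)-majorant bounds every matrix entry: |T(δ_{x′})(x)| ≦ K(blk x, blk x′) (the point mass δ_{x′} is supported in the block of x′
with |δ_{x′}| ≦ 1). [cite: Balaban1984PropagatorsII, (2.51) p.232] -/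
theorem entry_abs_le_of_hasMajorant (blk : X → g.Site) {T : Module.End ℝ (X → ℝ)} {K : g.Site → g.Site → ℝ}
    (hT : HasMajorant (g := b6 g) blk T K) (x x' : X) : |entry T x x'| ≤ K (blk x) (blk x') := by
  have hs : BlockSupp (g := b6 g) blk (Pi.single x' (1 : ℝ) : X → ℝ) (blk x') 1 := by
    refine ⟨zero_le_one, fun z _ => ?_, fun z hz => ?_⟩
    · by_cases h : z = x'
      · subst h; simp
      · simp [Pi.single_eq_of_ne h]
    · have h : z ≠ x' := fun h => hz (h ▸ rfl)
      simp [Pi.single_eq_of_ne h]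
  simpa [entry] using hT (blk x') _ 1 hs x

omit [Fintype g.Site] [Fintype ι] in
/-- Block norms are nonnegative (bookkeeping for the (2.51) reading). [cite: Balaban1984PropagatorsII, (2.51) p.232 (bookkeeping)] -/
theorem blockKer_nonneg (blk : X → g.Site) (T : Module.End ℝ (X → ℝ)) (y y' : g.Site) : 0 ≤ blockKer blk T y y' :=
  Real.iSup_nonneg fun _ => sum_nonneg fun _ _ => abs_nonneg _

omit [Fintype ι] in
/-- **The block norm is the least (2.51)-majorant**: a majorant K ≧ 0 at (y, y′) bounds the (y, y′) block norm — test (2.51) on the sign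
pattern of the row x over the block of y′. [cite: Balaban1984PropagatorsII, (2.51) p.232] -/
theorem blockKer_le_of_hasMajorant (blk : X → g.Site) {T : Module.End ℝ (X → ℝ)} {K : g.Site → g.Site → ℝ}
    (hT : HasMajorant (g := b6 g) blk T K) {y y' : g.Site} (hK : 0 ≤ K y y') : blockKer blk T y y' ≤ K y y' := by
  refine Real.iSup_le (fun x => ?_) hK
  -- the sign pattern of the row `x` over the block of `y′`
  set μ : X → ℝ := fun z => if blk z = y' then (if 0 ≤ entry T x.1 z then 1 else -1) else 0 with hμ
  have hsupp : BlockSupp (g := b6 g) blk μ y' 1 := by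
    refine ⟨zero_le_one, fun z hz => ?_, fun z hz => ?_⟩
    · simp only [hμ, hz, if_true]
      split_ifs <;> simp
    · simp only [hμ]
      exact if_neg hz
  have hTμ : T μ x.1 = ∑ x' ∈ univ.filter (fun x' => blk x' = y'), |entry T x.1 x'| := by
    rw [apply_eq_sum_entry, ← sum_filter_add_sum_filter_not univ (fun z => blk z = y')]
    have h0 : ∑ z ∈ univ.filter (fun z => ¬ blk z = y'), entry T x.1 z * μ z = 0 :=
      sum_eq_zero fun z hz => by simp [hμ, (mem_filter.mp hz).2]
    rw [h0, add_zero]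
    refine sum_congr rfl fun z hz => ?_
    have hz' : blk z = y' := (mem_filter.mp hz).2
    simp only [hμ, hz', if_true]
    split_ifs with h
    · rw [mul_one, abs_of_nonneg h]
    · rw [abs_of_neg (lt_of_not_ge h)]
      ring
  calc ∑ x' ∈ univ.filter (fun x' => blk x' = y'), |entry T x.1 x'| = T μ x.1 := hTμ.symm
    _ ≤ |T μ x.1| := le_abs_self _
    _ ≤ K (blk x.1) y' * 1 := hT y' μ 1 hsupp x.1
    _ = K y y' := by rw [x.2, mul_one]

omit [DecidableEq g.Site] [DecidableEq X] in
/-- **«THE OPERATOR R IS SMALL» ⇒ I − R IS INVERTIBLE, over the carrier** ([folklore] Neumann-series step of (3.96) ∕ [4] (2.64)–(2.65)): if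
R has the (2.51)-majorant θe^{−r·d(y,y′)}, (2.63) of [4] holds at (r, α′) with constant c ≧ 0, d(y, y) = 0, (1 − α′)r ≧ 0 and θc < 1, then
I − R is invertible on `X → ℝ` — a fixed vector v = Rv satisfies v = Rⁿv, whose majorant (θc)ⁿe^{−(1−α′)r·d} ([4] (2.65),
`B6Prop23Chain.majorant_pow_265W`) applied blockwise (`sum_blockPiece`) forces v = 0; finite dimension does the rest.  NO bound on the
fibres of `blk` is needed. [cite: Balaban1985BackgroundPropagators, (3.96) p.411; Balaban1984PropagatorsII, (2.64)–(2.65) p.234] -/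
theorem isUnit_one_sub_of_majorantBlk (blk : X → g.Site) (c r α' θ : ℝ) (hθ : 0 ≤ θ) (hc : 0 ≤ c)
    (hrefl : ∀ y : g.Site, g.dist y y = 0) (hdnn : ∀ a b : g.Site, 0 ≤ g.dist a b) (hαr : 0 ≤ (1 - α') * r)
    (h263 : Ineq263With c (b6 g) r α') (hsmall : θ * c < 1) {Rop : Module.End ℝ (X → ℝ)}
    (hR : HasMajorant (g := b6 g) blk Rop (fun a b => θ * Real.exp (-(r * g.dist a b)))) :
    IsUnit (1 - Rop) := by
  rw [LinearMap.isUnit_iff_ker_eq_bot, LinearMap.ker_eq_bot]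
  refine (injective_iff_map_eq_zero _).mpr fun f hf => ?_
  -- f = R f
  have hf' : Rop f = f := by
    have := hf
    rw [LinearMap.sub_apply, Module.End.one_apply, sub_eq_zero] at this
    exact this.symm
  -- f = Rⁿ f
  have hpow : ∀ n : ℕ, (Rop ^ n) f = f := by
    intro n
    induction n with
    | zero => simp
    | succ n ih => rw [pow_succ, Module.End.mul_apply, hf', ih]
  -- the bound B = Σ_x |f x| and the block pieces
  set Bf : ℝ := ∑ x, |f x| with hBf
  have hBf0 : 0 ≤ Bf := sum_nonneg fun _ _ => abs_nonneg _
  have hfx : ∀ x, |f x| ≤ Bf := fun x => single_le_sum (f := fun x => |f x|) (fun _ _ => abs_nonneg _) (mem_univ x)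
  have hq0 : 0 ≤ θ * c := mul_nonneg hθ hc
  -- |f x| ≤ (#𝔅)·(θc)ⁿ·B for every n
  have hbound : ∀ (n : ℕ) (x : X), |f x| ≤ (Fintype.card g.Site : ℝ) * (θ * c) ^ n * Bf := by
    intro n x
    have hmaj := B6Prop23Chain.majorant_pow_265W (g := b6 g) blk c r α' θ hθ hrefl h263 hR n
    have hdec : (Rop ^ n) f = ∑ y : g.Site, (Rop ^ n) (blockPiece (g := b6 g) blk y f) := by
      have h := congrArg (Rop ^ n) (sum_blockPiece (g := b6 g) blk f)
      rw [map_sum] at h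
      exact h.symm
    have hpiece : ∀ y : g.Site, |(Rop ^ n) (blockPiece (g := b6 g) blk y f) x| ≤ (θ * c) ^ n * Bf := by
      intro y
      have hs := blockSupp_blockPiece (g := b6 g) blk f y Bf hBf0 (fun z _ => hfx z)
      refine (hmaj y _ Bf hs x).trans ?_
      have hexp : Real.exp (-((1 - α') * r * (b6 g).dist (blk x) y)) ≤ 1 := by
        rw [Real.exp_le_one_iff, neg_nonpos]
        exact mul_nonneg hαr (hdnn _ _)
      calc (θ * c) ^ n * Real.exp (-((1 - α') * r * (b6 g).dist (blk x) y)) * Bf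
          ≤ (θ * c) ^ n * 1 * Bf :=
            mul_le_mul_of_nonneg_right (mul_le_mul_of_nonneg_left hexp (pow_nonneg hq0 n)) hBf0
        _ = (θ * c) ^ n * Bf := by ring
    calc |f x| = |(Rop ^ n) f x| := by rw [hpow n]
      _ = |∑ y : g.Site, (Rop ^ n) (blockPiece (g := b6 g) blk y f) x| := by rw [hdec, Finset.sum_apply]
      _ ≤ ∑ y : g.Site, |(Rop ^ n) (blockPiece (g := b6 g) blk y f) x| := abs_sum_le_sum_abs _ _
      _ ≤ ∑ _y : g.Site, (θ * c) ^ n * Bf := sum_le_sum fun y _ => hpiece y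
      _ = (Fintype.card g.Site : ℝ) * (θ * c) ^ n * Bf := by
          rw [sum_const, card_univ, nsmul_eq_mul]
          ring
  -- choose n with (#X)(#𝔅)(θc)ⁿ < 1
  set K : ℝ := (Fintype.card X : ℝ) * (Fintype.card g.Site : ℝ) with hK
  have hK0 : 0 ≤ K := by positivity
  obtain ⟨n, hn⟩ := exists_pow_lt_of_lt_one (show 0 < (K + 1)⁻¹ by positivity) hsmall
  have hKn : K * (θ * c) ^ n < 1 := by
    have h1 : K * (θ * c) ^ n ≤ (K + 1) * (θ * c) ^ n :=
      mul_le_mul_of_nonneg_right (by linarith) (pow_nonneg hq0 n)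
    have h2 : (K + 1) * (θ * c) ^ n < (K + 1) * (K + 1)⁻¹ := mul_lt_mul_of_pos_left hn (by positivity)
    rw [mul_inv_cancel₀ (by positivity)] at h2
    exact lt_of_le_of_lt h1 h2
  -- B ≤ K(θc)ⁿ·B forces B = 0
  have hBle : Bf ≤ K * (θ * c) ^ n * Bf := by
    calc Bf = ∑ x, |f x| := rfl
      _ ≤ ∑ _x : X, (Fintype.card g.Site : ℝ) * (θ * c) ^ n * Bf := sum_le_sum fun x _ => hbound n x
      _ = K * (θ * c) ^ n * Bf := by
          rw [sum_const, card_univ, nsmul_eq_mul, hK]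
          ring
  have hB0 : Bf = 0 := by
    have h : (1 - K * (θ * c) ^ n) * Bf ≤ 0 := by nlinarith
    have h1 : 0 < 1 - K * (θ * c) ^ n := by linarith
    have h2 : Bf ≤ 0 := by
      by_contra hneg
      push Not at hneg
      exact absurd h (not_le.mpr (mul_pos h1 hneg))
    linarith
  funext x
  have := hfx x
  rw [hB0] at this
  exact abs_nonpos_iff.mp this

omit [DecidableEq g.Site] in
/-- **(3.96) OVER THE CARRIER, smallness and constants explicit** (twin of `B9Thm39WholeGeneric.inverse_of_395With`): L·C₀ = I − R ((3.95)), the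
(3.48)-majorant A·P(y)e^{−r·d(y,y′)} of C₀, the (2.85)-shape majorant θe^{−r·d(y,y′)} of R, (2.61) at (r, α′) with constant c ≧ 0, α′ ≦ 1, r ≧ 0, the
metric facts, and θc < 1 ⇒ T := C₀(I − R)⁻¹ with T·L = I = L·T, T·(I − R) = C₀, T = C₀ + T·R, and the majorant A·c(1 − θc)⁻¹P(y)e^{−(1−α′)r·d(y,y′)}
([4] (2.66), `B6Prop23Chain.majorant_of_fixedPoint_266W`). [cite: Balaban1985BackgroundPropagators, (3.95)–(3.96) p.411; Balaban1984PropagatorsII, (2.66) p.234 + Prop. 2.3 p.238] -/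
theorem inverse_of_395Blk (blk : X → g.Site) (c r α' θ A : ℝ) (P : g.Site → ℝ)
    (hA : 0 ≤ A) (hP : ∀ y, 0 ≤ P y) (hθ : 0 ≤ θ) (hc : 0 ≤ c) (hr : 0 ≤ r) (hα' : α' ≤ 1)
    (htri : Triangle254 (b6 g)) (hrefl : ∀ y : g.Site, g.dist y y = 0)
    (hdnn : ∀ a b : g.Site, 0 ≤ g.dist a b) (h261 : Ineq261With c (b6 g) r α')
    (hsmall : θ * c < 1)
    {L C0 Rop : Module.End ℝ (X → ℝ)} (h395 : L * C0 = 1 - Rop)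
    (hC0 : HasMajorant (g := b6 g) blk C0 (fun a b => A * P a * Real.exp (-(r * g.dist a b))))
    (hR : HasMajorant (g := b6 g) blk Rop (fun a b => θ * Real.exp (-(r * g.dist a b)))) :
    ∃ T : Module.End ℝ (X → ℝ), T * L = 1 ∧ L * T = 1 ∧ T * (1 - Rop) = C0 ∧ T = C0 + T * Rop ∧
      HasMajorant (g := b6 g) blk T
        (fun a b => A * c * (1 - θ * c)⁻¹ * P a * Real.exp (-((1 - α') * r * g.dist a b))) := by
  have hαδ : 0 ≤ (1 - α') * r := mul_nonneg (sub_nonneg.mpr hα') hr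
  have h263 : Ineq263With c (b6 g) r α' := ineq263With_of_261With htri hr hα' h261
  obtain ⟨u, hu⟩ := isUnit_one_sub_of_majorantBlk blk c r α' θ hθ hc hrefl hdnn hαδ h263 hsmall hR
  have hLT : L * (C0 * ↑u⁻¹) = 1 := by
    rw [← mul_assoc, h395, ← hu, Units.mul_inv]
  have hTL : C0 * ↑u⁻¹ * L = 1 := mul_eq_one_symm hLT
  have hTR : C0 * ↑u⁻¹ * (1 - Rop) = C0 := by
    rw [mul_assoc, ← hu, Units.inv_mul, mul_one]
  have hfix : C0 * ↑u⁻¹ = C0 + C0 * ↑u⁻¹ * Rop := by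
    have h := hTR
    rw [mul_sub, mul_one, sub_eq_iff_eq_add] at h
    exact h
  refine ⟨C0 * ↑u⁻¹, hTL, hLT, hTR, hfix, ?_⟩
  exact B6Prop23Chain.majorant_of_fixedPoint_266W (g := b6 g) blk c r α' θ A P hA hP hθ hc hαδ htri hrefl hdnn h261 h263
    hsmall hC0 hR hfix

omit [Fintype g.Site] [DecidableEq g.Site] [Fintype X] [DecidableEq X] in
/-- **(3.95): Q′G′²Q′\*C₀ = I − R** over the carrier, from L_□C_□ = I, □̃h_□ = h_□ and Σ_□h_□² = I (`B9Thm39Sum.eq395_oneSub`, an identity in any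
ring; p. 411: *"We write it in the same way as in (2.82) [4]"*). [cite: Balaban1985BackgroundPropagators, (3.95) p.411; Balaban1984PropagatorsII, (2.82) p.237] -/
theorem L_mul_C0_eqBlk (𝔬 : Ops39Blk g B X ι κ) (U : B.Cfg) (hpu : ∀ x, ∑ i, 𝔬.h i x ^ 2 = 1)
    (hchi : ∀ i x, 𝔬.chi i x * 𝔬.h i x = 𝔬.h i x) (hinv : ∀ i : ι, 𝔬.Lloc U i * 𝔬.Cl U i = 1) :
    𝔬.L U * C0Blk 𝔬 U = 1 - RopBlk 𝔬 U := by
  have hχ : ∀ i, mulOp (𝔬.chi i) * mulOp (𝔬.h i) = mulOp (𝔬.h i) := by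
    intro i
    apply LinearMap.ext
    intro μ
    funext x
    simp only [Module.End.mul_apply, mulOp_apply]
    rw [← mul_assoc, hchi i x]
  exact eq395_oneSub (𝔬.L U) (fun i => mulOp (𝔬.h i)) (fun i => mulOp (𝔬.chi i)) (fun i => 𝔬.Cl U i)
    (fun i => 𝔬.Lloc U i) (fun i => hloc_of_inverse (hinv i) (hχ i)) (sum_mulOp_sq 𝔬.h hpu)

omit [Fintype X] [DecidableEq X] in
/-- **C₀ = Σ_□ h_□C_□h_□ obeys (3.48), localized**, over the carrier (twin of `B9Thm39Sum.c0_majorant`): if every C_□ has the majorant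
A·P(y)e^{−r·d(y,y′)}, |h_□| ≦ 1 on `X`, h_□ ≠ 0 only over S_□ and every site lies in at most N of the S_□, then C₀ has the majorant
N·A·P(y)e^{−r·d(y,y′)} (`B9Thm37Sum.hasMajorant_localSum`, `hasMajorant_sandwich_local`). [cite: Balaban1985BackgroundPropagators, (3.87) p.409 + Thm 3.2 (3.48) p.398] -/
theorem c0_majorantBlk (blk : X → g.Site) (A r N : ℝ) (P : g.Site → ℝ) (S : ι → Finset g.Site)
    (h : ι → X → ℝ) (Cl : ι → Module.End ℝ (X → ℝ)) (hA : 0 ≤ A) (hP : ∀ y, 0 ≤ P y)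
    (hh : ∀ i x, |h i x| ≤ 1) (hS : ∀ i x, h i x ≠ 0 → blk x ∈ S i)
    (hC : ∀ i, HasMajorant (g := b6 g) blk (Cl i) (fun a b => A * P a * Real.exp (-(r * g.dist a b))))
    (hcnt : ∀ a : g.Site, (∑ i, if a ∈ S i then (1 : ℝ) else 0) ≤ N) :
    HasMajorant (g := b6 g) blk (∑ i, mulOp (h i) * Cl i * mulOp (h i))
      (fun a b => N * (A * P a * Real.exp (-(r * g.dist a b)))) := by
  refine hasMajorant_localSum (G := b6 g) blk _ (fun i (a : g.Site) => if a ∈ S i then (1 : ℝ) else 0) _ N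
    (fun a b => mul_nonneg (mul_nonneg hA (hP a)) (Real.exp_nonneg _)) (fun i => ?_) hcnt
  refine hasMajorant_mono (g := b6 g) _
    (hasMajorant_sandwich_local (R := 0) (H := True) blk (hC i) (h i) (hh i) (S i) (hS i)) fun a b => le_of_eq ?_
  split_ifs <;> simp

/-- **THEOREM 3.9's FIRST CLAUSE AT ONE MEMBER AND ONE U, OVER THE CARRIER — (3.96) ⇒ (3.48) for (Q′G′²Q′\*)⁻¹** with (2.61) in the generic-constant
form: from `StaticOK39Blk`, (3.48) for the C_□(U) at (B₀, δ₀) (`Local348Blk`; rate weakened to r ≦ δ₀), L_□C_□ = I (`Identities395Blk`), the (2.85)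
majorant of R at (θ₀M⁻¹, r) (`Small285Blk`), [4] Lemma 2.1 (2.61) at (r, α′) with constant c′ ≧ 0, α′ ≦ 1, and «M sufficiently large» LOCATED
as M ≧ 2θ₀c′: `Conv348Blk 𝔬 (2NB₀c′) ((1 − α′)r) U` — the SAME constants as the scalar face `B9Thm39WholeGeneric.conv348_of_local348With`.
[cite: Balaban1985BackgroundPropagators, (3.95)–(3.96) p.411 + Thm 3.2 (3.48) p.398; Balaban1984PropagatorsII, (2.85)–(2.87) p.238 + Lemma 2.1 (2.61) p.234] -/
theorem conv348Blk_of_local348 (𝔬 : Ops39Blk g B X ι κ) (c' r α' θ₀ B₀ δ₀ N : ℝ) (U : B.Cfg)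
    (hc' : 0 ≤ c') (hr : 0 ≤ r) (hrδ : r ≤ δ₀) (hα' : α' ≤ 1) (hθ₀ : 0 ≤ θ₀) (hB₀ : 0 ≤ B₀) (hN : 0 ≤ N)
    (hM : 0 < g.M) (hMbig : 2 * θ₀ * c' ≤ g.M) (hs : StaticOK39Blk 𝔬 N) (h261 : Ineq261With c' (b6 g) r α')
    (hl : Local348Blk 𝔬 B₀ δ₀ U) (hi : Identities395Blk 𝔬 U) (hR : Small285Blk 𝔬 θ₀ r U) :
    Conv348Blk 𝔬 (2 * (N * B₀) * c') ((1 - α') * r) U := by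
  have hlen : ∀ y : g.Site, 0 < g.len y := hs.lenpos
  have htri : Triangle254 (b6 g) := fun a b e => hs.tri a b e
  set P : g.Site → ℝ := fun y => g.len y ^ (-(4 : ℝ)) with hPdef
  have hP : ∀ y, 0 ≤ P y := fun y => Real.rpow_nonneg (hlen y).le _
  set θ : ℝ := θ₀ * g.M⁻¹ with hθdef
  have hθ : 0 ≤ θ := mul_nonneg hθ₀ (inv_nonneg.mpr hM.le)
  -- the located smallness: θc′ ≤ 1/2 from M ≥ 2θ₀c′
  have hθc : θ * c' ≤ 1 / 2 := by
    rw [hθdef]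
    have h1 : θ₀ * c' ≤ g.M / 2 := by nlinarith
    calc θ₀ * g.M⁻¹ * c' = θ₀ * c' / g.M := by ring
      _ ≤ g.M / 2 / g.M := div_le_div_of_nonneg_right h1 hM.le
      _ = 1 / 2 := by field_simp
  have hsmall : θ * c' < 1 := by linarith
  -- (3.95)
  have h395 : 𝔬.L U * C0Blk 𝔬 U = 1 - RopBlk 𝔬 U := L_mul_C0_eqBlk 𝔬 U hs.hpu hs.hchi hi.inv
  -- the (3.48)-majorants of the C_□(U) at the weaker rate r
  have hC : ∀ i, HasMajorant (g := b6 g) 𝔬.blk (𝔬.Cl U i)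
      (fun (a b : g.Site) => B₀ * P a * Real.exp (-(r * g.dist a b))) := by
    intro i
    refine hasMajorant_mono (g := b6 g) _ (hl.cl i) fun a b => ?_
    have hexp : Real.exp (-(δ₀ * g.dist a b)) ≤ Real.exp (-(r * g.dist a b)) :=
      Real.exp_le_exp.mpr (by nlinarith [hs.dnn a b])
    exact mul_le_mul_of_nonneg_left hexp (mul_nonneg hB₀ (hP a))
  -- C₀ obeys (3.48) with NB₀ (localized sum)
  have hC0 := c0_majorantBlk 𝔬.blk B₀ r N P 𝔬.S 𝔬.h (fun i => 𝔬.Cl U i) hB₀ hP hs.hh hs.hS hC hs.cnt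
  have hC0' : HasMajorant (g := b6 g) 𝔬.blk (C0Blk 𝔬 U)
      (fun (a b : g.Site) => N * B₀ * P a * Real.exp (-(r * g.dist a b))) :=
    hasMajorant_mono (g := b6 g) _ hC0 fun a b => le_of_eq (by ring)
  obtain ⟨T, hTL, hLT, -, -, hmaj⟩ := inverse_of_395Blk 𝔬.blk c' r α' θ (N * B₀) P (mul_nonneg hN hB₀) hP hθ hc' hr hα'
    htri hs.refl hs.dnn h261 hsmall h395 hC0' hR.rk
  refine ⟨T, hTL, hLT, hasMajorant_mono (g := b6 g) _ hmaj fun a b => ?_⟩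
  have hinv : (1 - θ * c')⁻¹ ≤ 2 := by
    rw [inv_le_comm₀ (by linarith) (by norm_num : (0 : ℝ) < 2)]
    linarith
  have hconst : N * B₀ * c' * (1 - θ * c')⁻¹ ≤ 2 * (N * B₀) * c' := by
    calc N * B₀ * c' * (1 - θ * c')⁻¹ ≤ N * B₀ * c' * 2 :=
          mul_le_mul_of_nonneg_left hinv (mul_nonneg (mul_nonneg hN hB₀) hc')
      _ = 2 * (N * B₀) * c' := by ring
  have hrest : 0 ≤ P a * Real.exp (-((1 - α') * r * g.dist a b)) := mul_nonneg (hP a) (Real.exp_nonneg _)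
  calc N * B₀ * c' * (1 - θ * c')⁻¹ * P a * Real.exp (-((1 - α') * r * g.dist a b))
      = N * B₀ * c' * (1 - θ * c')⁻¹ * (P a * Real.exp (-((1 - α') * r * g.dist a b))) := by ring
    _ ≤ 2 * (N * B₀) * c' * (P a * Real.exp (-((1 - α') * r * g.dist a b))) := mul_le_mul_of_nonneg_right hconst hrest
    _ = 2 * (N * B₀) * c' * g.len a ^ (-(4 : ℝ)) * Real.exp (-((1 - α') * r * g.dist a b)) := by rw [hPdef]; ring

omit [Fintype g.Site] [DecidableEq g.Site] [Fintype ι] [Fintype X] [DecidableEq X] in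
/-- Left-nested products only read their first n + 1 factors. [folklore] -/
private theorem lprod_congr {F F' : ℕ → Module.End ℝ (X → ℝ)} :
    ∀ (n : ℕ), (∀ k, k ≤ n → F k = F' k) → lprod F n = lprod F' n := by
  intro n
  induction n generalizing F F' with
  | zero => intro h; exact h 0 le_rfl
  | succ n ih =>
      intro h
      show F 0 * lprod (fun i => F (i + 1)) n = F' 0 * lprod (fun i => F' (i + 1)) n
      rw [h 0 (Nat.zero_le _), ih (fun k hk => h (k + 1) (by omega))]

omit [Fintype ι] in
/-- **The U-localisation clause of Theorem 3.9** at `EK39OfOpsBlk`, from the printed locality inputs (`Locality39Blk`).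
[cite: Balaban1985BackgroundPropagators, Thm 3.9 p.413] -/
theorem locDep_EK39OfOpsBlk (𝔬 : Ops39Blk g B X ι κ) (rd : WalkReading39 B ι κ) (d : ℕ) (B₁ δ₁ : ℝ) (hloc : Locality39Blk 𝔬 rd)
    (U : B.Cfg) (w : ℕ × ι × (ℕ → κ)) : (EK39OfOpsBlk 𝔬 rd d B₁ δ₁).LocDep U w := by
  intro U' hC hX
  refine lprod_congr w.1 fun k hk => ?_
  by_cases hk0 : k = 0
  · subst hk0
    rw [walkOpsBlk_zero, walkOpsBlk_zero]
    exact hloc.cl w.2.1 U U' hC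
  · rw [walkOpsBlk_of_ne 𝔬 U w.2.1 w.2.2 hk0, walkOpsBlk_of_ne 𝔬 U' w.2.1 w.2.2 hk0]
    exact hloc.rw (w.2.2 k) U U' (hX k (Nat.one_le_iff_ne_zero.mpr hk0) hk)

/-- **THE BOUND (3.99) at one member and one configuration U, OVER THE CARRIER**, (2.61) at α with constant c ≧ 0: at the datum `EK39OfOpsBlk`,
|kterm| ≦ (L^jη)^{−4}(L^{j′}η)^{−d}·walkFactor(B₀, (θ₀c + 1)M^{−1/2}, M, 2(1 − α)δ₀)(|ω|, d(ω, y, y′)) — from (3.48) for C_{□₀}(U) (`Local348Blk`; head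
localized by `B9Thm37Sum.hasMajorant_sandwich_local`), the (3.89)-type factor majorants (`Factors389Blk`), the chain estimate
`B9Thm39WholeGeneric.term399_majorantWith` ((3.91)–(3.94)), the block norm bounded by the majorant (`blockKer_le_of_hasMajorant`),
`B9Cor38Whole.LB_minLen` ((3.93)) and `B9.split_small_factor`. [cite: Balaban1985BackgroundPropagators, Thm 3.9 (3.99) p.413 + Cor. 3.8 (3.91)–(3.94) p.410 + (3.89) p.409; Balaban1984PropagatorsII, Lemma 2.1 (2.61) p.234] -/
theorem kterm_EK39OfOpsBlk_le (𝔬 : Ops39Blk g B X ι κ) (rd : WalkReading39 B ι κ) (c : ℝ) (d : ℕ)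
    (B₁ δ₁ δ₀ α θ₀ B₀ N : ℝ) (U : B.Cfg) (hc : 0 ≤ c) (hδ₀ : 0 ≤ δ₀) (hα : 0 ≤ α) (hα1 : α ≤ 1) (hθ₀ : 0 ≤ θ₀)
    (hB₀ : 0 ≤ B₀) (hM : 0 < g.M) (hs : StaticOK39Blk 𝔬 N) (h261 : Ineq261With c (b6 g) δ₀ α)
    (hl : Local348Blk 𝔬 B₀ δ₀ U) (hf : Factors389Blk 𝔬 θ₀ δ₀ U) (w : ℕ × ι × (ℕ → κ)) (y y' : g.Site) :
    |(EK39OfOpsBlk 𝔬 rd d B₁ δ₁).kterm U w y y'| ≤ g.len y ^ (-(4 : ℝ)) * g.len y' ^ (-(d : ℝ)) *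
      B9.walkFactor B₀ (θ₀ * c + 1) g.M (2 * ((1 - α) * δ₀)) ((EK39OfOpsBlk 𝔬 rd d B₁ δ₁).wlen w)
        ((EK39OfOpsBlk 𝔬 rd d B₁ δ₁).wdist w y y') := by
  obtain ⟨n, q, ω⟩ := w
  have hlen : ∀ z : g.Site, 0 < g.len z := hs.lenpos
  have hvol := vol_pos d hlen
  have hMinv : 0 ≤ g.M⁻¹ := inv_nonneg.mpr hM.le
  have hθ : 0 ≤ θ₀ * g.M⁻¹ := mul_nonneg hθ₀ hMinv
  have hαδ : 0 ≤ α * δ₀ := mul_nonneg hα hδ₀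
  have h1αδ : 0 ≤ (1 - α) * δ₀ := mul_nonneg (by linarith) hδ₀
  set S : ℕ → Finset g.Site := walkSetsBlk 𝔬 q ω with hSdef
  set W₀ : g.Site → ℝ := fun a => B₀ * g.len a ^ (-(4 : ℝ)) with hW₀def
  have hW₀ : ∀ a, 0 ≤ W₀ a := fun a => mul_nonneg hB₀ (Real.rpow_nonneg (hlen a).le _)
  -- the head factor h_{□₀}C_{□₀}h_{□₀}: (3.48) for C_{□₀}, localized to S_{□₀}
  have hCq : HasMajorant (g := b6 g) 𝔬.blk (𝔬.Cl U q) (fun (a b : g.Site) => W₀ a * Real.exp (-(δ₀ * g.dist a b))) :=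
    hasMajorant_mono (g := b6 g) _ (hl.cl q) fun a b => le_of_eq (by rw [hW₀def])
  have hT0 : HasMajorant (g := b6 g) 𝔬.blk (walkOpsBlk 𝔬 U q ω 0)
      (fun (a b : g.Site) => if a ∈ S 0 then W₀ a * Real.exp (-(δ₀ * g.dist a b)) else 0) := by
    rw [walkOpsBlk_zero]
    have h := hasMajorant_sandwich_local (R := 0) (H := True) 𝔬.blk hCq (𝔬.h q) (hs.hh q) (𝔬.S q) (hs.hS q)
    refine hasMajorant_mono (g := b6 g) _ h fun a b => le_of_eq ?_
    rw [hSdef, walkSetsBlk_zero]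
  -- the factors R′_{α_k}(X_k), k ≥ 1
  have hR : ∀ i, 1 ≤ i → i ≤ n → HasMajorant (g := b6 g) 𝔬.blk (walkOpsBlk 𝔬 U q ω i)
      (fun (a b : g.Site) => if a ∈ S i then θ₀ * g.M⁻¹ * Real.exp (-(δ₀ * g.dist a b)) else 0) := by
    intro i hi _
    have hi0 : i ≠ 0 := by omega
    rw [walkOpsBlk_of_ne 𝔬 U q ω hi0]
    refine hasMajorant_mono (g := b6 g) _ (hf.rw (ω i)) fun a b => le_of_eq ?_
    rw [hSdef, walkSetsBlk_of_ne 𝔬 q ω hi0]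
  -- the chain estimate ⇒ (3.99)-shape majorant of the term
  have hmaj := term399_majorantWith (R := 0) (H := True) 𝔬.blk c δ₀ α (θ₀ * g.M⁻¹) W₀ S (walkOpsBlk 𝔬 U q ω)
    (minLen g.dist S n) n hW₀ hθ hs.dnn hαδ h1αδ h261 hT0 hR (fun a b => LB_minLen g.dist n S a b)
  -- the block norm is bounded by the majorant
  have hKnn : 0 ≤ (if y ∈ S 0 then W₀ y else 0) * (θ₀ * g.M⁻¹ * c) ^ n *
      Real.exp (-((1 - α) * δ₀ * minLen g.dist S n y y')) := by
    refine mul_nonneg (mul_nonneg ?_ (pow_nonneg (mul_nonneg hθ hc) n)) (Real.exp_nonneg _)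
    split_ifs
    · exact hW₀ y
    · exact le_rfl
  have hbk := blockKer_le_of_hasMajorant 𝔬.blk hmaj (y := y) (y' := y') hKnn
  -- arithmetic (as in the scalar face)
  have hhead : (if y ∈ S 0 then W₀ y else 0) ≤ B₀ * g.len y ^ (-(4 : ℝ)) := by
    split_ifs
    · exact le_rfl
    · exact mul_nonneg hB₀ (Real.rpow_nonneg (hlen y).le _)
  have hθc : θ₀ * g.M⁻¹ * c ≤ (θ₀ * c + 1) * g.M⁻¹ := by
    have h0 : 0 ≤ 1 * g.M⁻¹ := by rw [one_mul]; exact hMinv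
    nlinarith
  have hpow : (θ₀ * g.M⁻¹ * c) ^ n ≤ ((θ₀ * c + 1) * g.M⁻¹) ^ n :=
    pow_le_pow_left₀ (mul_nonneg hθ hc) hθc n
  have hexp : Real.exp (-((1 - α) * δ₀ * minLen g.dist S n y y')) =
      Real.exp (-(2 * ((1 - α) * δ₀) / 2 * minLen g.dist S n y y')) := by
    congr 1
    ring
  have hE : 0 ≤ Real.exp (-((1 - α) * δ₀ * minLen g.dist S n y y')) := Real.exp_nonneg _
  have hfac : (if y ∈ S 0 then W₀ y else 0) * (θ₀ * g.M⁻¹ * c) ^ n *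
        Real.exp (-((1 - α) * δ₀ * minLen g.dist S n y y')) * (vol g d y')⁻¹ ≤
      g.len y ^ (-(4 : ℝ)) * g.len y' ^ (-(d : ℝ)) *
        B9.walkFactor B₀ (θ₀ * c + 1) g.M (2 * ((1 - α) * δ₀)) n (minLen g.dist S n y y') := by
    rw [vol_inv d hlen y']
    have hvd : 0 ≤ g.len y' ^ (-(d : ℝ)) := Real.rpow_nonneg (hlen y').le _
    calc (if y ∈ S 0 then W₀ y else 0) * (θ₀ * g.M⁻¹ * c) ^ n *
          Real.exp (-((1 - α) * δ₀ * minLen g.dist S n y y')) * g.len y' ^ (-(d : ℝ))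
        ≤ B₀ * g.len y ^ (-(4 : ℝ)) * ((θ₀ * c + 1) * g.M⁻¹) ^ n *
          Real.exp (-((1 - α) * δ₀ * minLen g.dist S n y y')) * g.len y' ^ (-(d : ℝ)) := by
          refine mul_le_mul_of_nonneg_right (mul_le_mul_of_nonneg_right ?_ hE) hvd
          exact mul_le_mul hhead hpow (pow_nonneg (mul_nonneg hθ hc) n)
            (mul_nonneg hB₀ (Real.rpow_nonneg (hlen y).le _))
      _ = g.len y ^ (-(4 : ℝ)) * g.len y' ^ (-(d : ℝ)) *
          B9.walkFactor B₀ (θ₀ * c + 1) g.M (2 * ((1 - α) * δ₀)) n (minLen g.dist S n y y') := by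
          rw [B9.split_small_factor (θ₀ * c + 1) g.M hM n, hexp]
          simp only [B9.walkFactor]
          ring
  show |blockKer 𝔬.blk (lprod (walkOpsBlk 𝔬 U q ω) n) y y' / vol g d y'| ≤ g.len y ^ (-(4 : ℝ)) * g.len y' ^ (-(d : ℝ)) *
    B9.walkFactor B₀ (θ₀ * c + 1) g.M (2 * ((1 - α) * δ₀)) n (minLen g.dist (walkSetsBlk 𝔬 q ω) n y y')
  rw [← hSdef, abs_of_nonneg (div_nonneg (blockKer_nonneg _ _ _ _) (hvol y').le), div_eq_mul_inv]
  exact (mul_le_mul_of_nonneg_right hbk (inv_nonneg.mpr (hvol y').le)).trans hfac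

end OneMember

end

end Literature.MathematicalPhysics.QuantumFieldTheory.Balaban1983to89.B9Thm39WholeBlk
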